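import HarnessLib
import Summits.NavierStokesRegularity.NavierStokesRegularity.Theses.QuarterLogPincer
import Summits.NavierStokesRegularity.NavierStokesRegularity.Theorems.QuarterLogPincerTypeIQuantSubcubicExpFrameTools
import Summits.NavierStokesRegularity.NavierStokesRegularity.Theorems.QuarterLogPincerTypeIQuantSubcubicExpStubUniformScaledEnergy
import Literature.Analysis.FluidPDE.ESSLocalHolderNoConcentration
import Literature.Analysis.FluidPDE.EssCurry
import Literature.Analysis.FluidPDE.BackwardUniquenessRescale

/-!
# LINE `smooth_silence` (ns-idea-7 g12, line 4; lens «nearmiss», target «DSS wall») — crux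
`QuarterLogPincer.TypeIQuantSubcubicExp` (stmt-NavierStokesRegularity-24077, LADDER-NS wall W7)

**No summit is proved by this line.**  Its target BY NAME is `ember_census`'s load-bearing statement
**`TerminalEmber`** (E2; `Lines/ember_census.lean` v1.1 65d69ceac529, `Lines/silencing_cost.lean` v1.1
338118c44af2 — restated VERBATIM below with `Hot`, `Terminal`, `BoxBound`, Sb `VorticalCentre`, Sd
`EmberReadout`; namespace `SmoothSilence`), which this file proves (`terminalEmber_of_smooth_stubs`) from FIVE
stubs and NOTHING ELSE — **v1.1: no literature hypothesis; v1.2: Sd `EmberReadout` is PROVED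
(`emberReadout_holds`, standard axioms), so the stubs are Sa♯, Sb, Sv♯, L♯1, L♯2.**  The backward-uniqueness step is the tree's
PROVED chain **`Literature.Analysis.FluidPDE.Carleman.backwardUniqueness_uncurried_c12`** (Seregin 2014 Thm 3.5 =
Escauriaza–Seregin–Šverák 2003 Thm 5.1, in the class `C¹₂` = jointly `C¹` with jointly `C¹` spatial gradient)
with its unique-continuation input **`uniqueContinuation_input_c12`** (= `Carleman.uniqueContinuation_uncurried_c12
3 3`, ESS Thm 4.1, PROVED), consumed BY NAME in the proved kernel `no_smoothVanishingWitness`.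
VERSIONS: v1 (f186bc829270, PASS idea-crit-4 g8 07:07Z) took the tree's open FACT `ess_backward_uniqueness_C1`
(class `C¹_t ∩ C²_x`) as the hypothesis `hESS`; v1.1 raises the line's regularity class by ONE ORDER (Sa♯:
`j ≤ 6` and a time modulus for `∇²u`; drift–stretch box: `ω` to order 5, `v` to order 4 with a `∇²v` modulus —
same printed sources, same I1) so that L♯2's Arzelà–Ascoli limit lands in `C¹₂`, and DROPS `hESS`: the ember
branch now rests on stubs + PROVED tree theorems only (the critic's weight note (1) on v1 is discharged
without a prover seat).

## Why this line (the near-miss it repairs)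
Line 3 `limit_silence` (cc13b3316587) reduced the branch's last conjectural statement Sc′ to compactness + an
`L`-sized PORT L2 `NoWitness` = ESS backward uniqueness for a `W^{2,1}_{q,loc}` distributional witness.  Its
card said «no backward-uniqueness decl in tree» — WRONG: the tree HAS ESS Thm 5.1 — PROVED for jointly `C²`
fields (`ess_backward_uniqueness_holds`) and for the class `C¹₂` (`Carleman.backwardUniqueness_uncurried_c12`), a
named FACT for `C¹_t ∩ C²_x` (`ess_backward_uniqueness_C1`) — but line 3's witness (a limit in the NS-FREE
inequality class, whose source `F` is only `L^∞`) can never be smoother than `W^{2,1}_q`: the inequality class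
cannot be mollified.  MEASURED DEFICIT: one derivative (in time, and — for `C¹₂` — one mixed derivative
`∂ₛ∇`), between the witness line 3 produces and the witnesses the tree's theorems exclude.  THE SINGLE
INPUT THAT CLOSES IT: keep the Navier–Stokes STRUCTURE through the limit.  In the aftermath box the vorticity
solves the LINEAR DRIFT–STRETCH equation `∂ₛω = Δω + (ω·∇)u − (u·∇)ω` whose coefficient `u` has, by
ε-regularity seeded by the tree's PROVED I1 `UniformScaledEnergy` (which CONTROLS THE PRESSURE:
`r⁻²∫∫|p − (p)_r|^{3/2} ≤ C(M)`), scale-`σ` bounds on `∇ʲu` (`j ≤ 6`) AND a `γ`-Hölder modulus in time (`γ = γ(ε,M) > 0`) for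
`u, ∇u, ∇²u` (`∂ₜu = Δu − u·∇u − ∇p`, harmonic part of `p` in `L^{3/2}_t L^∞_x`).  This class — unlike the
inequality class — is CLOSED under locally uniform limits with a limit that is jointly `C¹` WITH JOINTLY `C¹`
GRADIENT and `C²` slices (`∂ₛωₙ = Δωₙ + Gₙ` and `∂ₛ∇ωₙ = ∇(Δωₙ + Gₙ)` converge locally uniformly because
`uₙ, ∇uₙ, ∇²uₙ` are equicontinuous IN TIME; no pressure enters the vorticity equation), i.e. exactly a field the
tree's PROVED `Carleman.backwardUniqueness_uncurried_c12` kills after the time reversal `s ↦ 1 − s` — and THAT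
step is PROVED here, unconditionally (`no_smoothVanishingWitness`, §W).  Net effect on the ember branch toward
R: the out-of-tree `L` port L2 of line 3 is replaced by PROVED tree theorems; the price is moved into
Sa♯ (`SharpAftermath`: higher interior derivatives + the time modulus — print: Caffarelli–Kohn–Nirenberg /
Gustafson–Kang–Tsai ε-regularity, higher interior regularity [Seregin LN Lemma 6.1 + Remark 6.1, p.90:
`∇^{k−1}U` Hölder continuous in `Q̄(½)` for every `k` — CKN 1982 / Ladyzhenskaya–Seregin 1999 / Nečas–Růžička–Šverák
1996 Prop. 2.1], and the I1 pressure term for the time modulus [Seregin LN p.58: the local Stokes system does not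
smooth in time — Serrin's `c(t)∇h(x)` — and is Hölder in time exactly under pressure integrability]) and Sv♯ (`VorticityTransport`: calculus; the vorticity equation is the tree's PROVED
`IsClassicalNSSolutionOn.isVorticitySolutionOn_Icc`).

## Stubs (5) and kernel
Sa♯ `stub_sharpAftermath : SharpAftermath` (M–L, print + I1) · Sb `stub_vorticalCentre : VorticalCentre`
(verbatim, M) · Sv♯ `stub_vorticityTransport : VorticityTransport` (M, calculus + tree) · L♯1
`stub_smoothNormalisation : SmoothNormalisation` (S–M, rescaling) · L♯2 `stub_smoothLimitStep :
SmoothLimitStep` (M–L, Arzelà–Ascoli bookkeeping — THE analytic step).  KERNEL (proved, no sorry outside the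
stubs; standard axioms): **`emberReadout_holds : EmberReadout` (Sd, PROVED in v1.2 — verbatim statement of
`silencing_cost`'s Sd: enstrophy mass ⇒ a point with `|curl v| ≥ aσ⁻²` ⇒ `‖Dv‖ ≥ (a/4)σ⁻²`
(`norm_curl_le_four_mul`) ⇒ a unit direction nearly attaining it ⇒ second-order Taylor step (mean value twice,
`‖D²v‖ ≤ M₁σ⁻³`) gives a point with `|v| ≥ bσ⁻¹` ⇒ Lipschitz persistence on `B(x₂, rσ)` ⇒
`∫|v|³ ≥ (b/2)³r³·|B₁| =: c'`, σ-free; `EuclideanSpace.volume_ball`)**, `lap_uncurry_c12` (dictionary: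
frame Laplacian = slice Laplacian in `C¹₂`), `no_smoothVanishingWitness`
(the tree's C12 chain applied on every half-space after time reversal; `x = 0` and `s = 0` by continuity),
`driftStretchSilencingCost_of` (contradiction), `sharpEnstrophyPersistence_of` (Sv♯ + Sc″),
`terminalEmber_of_sharp` (E2 kernel of `silencing_cost` with the sharp box), `terminalEmber_of_smooth_stubs :
TerminalEmber` (no hypothesis).

Why novel (problem-relative): first use on this crux of the vorticity-transport STRUCTURE to lift the compactness
limit into the regularity class of the tree's PROVED ESS chain, with the pressure — the usual enemy of time-regularity —
tamed by the PROVED I1 pressure clause; nearest = line 3 (inequality class, `W^{2,1}` witness, out-of-tree ESS).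
bears_on: TerminalEmber (by name) → FlarePersistence (`ember_census` K1+K2, proved) → BeadCensus → (G2
`BPChainRate`) → R `TypeIQuantCubicExp` → (`typeIQuantCubicExp_of_typeIQuantSubcubicExp`) the crux is the
stronger statement; R is the W7 «R0-rate» rung.  Instrument row: NEARMISS-CENSUS-g12 row 77.
Cheapest falsifier: a sequence in the normalised drift–stretch class (`SmoothFailingFamily`) whose locally
uniform limit is NOT `C¹` in time — impossible by the equation unless the time moduli of `v, ∇v` are dropped
(then Serrin's example `v = a(s)∇h` with rough `a` breaks L♯2 at once: this is why the moduli are in the class).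
-/

set_option linter.dupNamespace false

namespace Summit.NavierStokesRegularity.NavierStokesRegularity.Cruxes.TypeIQuantSubcubicExp.SmoothSilence

noncomputable section

open MeasureTheory Set Function Filter Topology Metric
open scoped ENNReal NNReal Classical Laplacian InnerProductSpace RealInnerProductSpace
open Literature.Analysis Literature.Analysis.FluidPDE
open Summit.NavierStokesRegularity.NavierStokesRegularity.Theorems.ThinCascade

local notation "E3" => EuclideanSpace ℝ (Fin 3)

/-! ## §E  The target E2 `TerminalEmber` and its vocabulary (VERBATIM from `ember_census` / `silencing_cost`) -/

/-- **HOT EVENT** at `(y,t)` for the virtual blow-up time `T'` (`= T + τ`) and threshold `ε`: the velocity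
at `(y,t)` exceeds `ε` in CLOCK units, `ε < √(T'−t)·‖u(t,y)‖`, and there is parabolic room below it
(`T' − t ≤ t`, so the box `(t − (T'−t), t]` lies in `[0,T]`).  Pointwise and clock-relative ON PURPOSE: on an
«ε-cold» region (`‖u(s,x)‖ ≤ ε(T'−s)^{-1/2}`) the Gustafson–Kang–Tsai `(p,q) = (∞,1)` quantity
`ρ⁻¹ ∫_{t₀−ρ²}^{t₀} sup_{B_ρ} |u| ds ≤ 2ε` at EVERY scale `ρ` — the `L¹`-in-time norm integrates the clock —
so cold regions are quantitatively regular at every scale, not only at the clock scale. -/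
def Hot (ε T' : ℝ) (u : ℝ → E3 → E3) (y : E3) (t : ℝ) : Prop :=
  T' - t ≤ t ∧ ε < Real.sqrt (T' - t) * ‖u t y‖

/-- **TERMINAL** hot event (aperture `K`, horizon `t₁`): no hot event FOLLOWS `(y,t)` — at a later time
`≤ t₁`, at clock at most half (`4(T'−t') ≤ T'−t`), within `4K√(T'−t)` of `y`.  The aftermath
`B(y, 4K√(T'−t)) × {t < s ≤ t₁ : 4(T'−s) ≤ T'−t}` of a terminal event is ε-cold. -/
def Terminal (K ε T' t₁ : ℝ) (u : ℝ → E3 → E3) (y : E3) (t : ℝ) : Prop :=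
  ∀ (y' : E3) (t' : ℝ), t < t' → t' ≤ t₁ → 4 * (T' - t') ≤ T' - t →
    ‖y' - y‖ ≤ 4 * K * Real.sqrt (T' - t) → ¬ Hot ε T' u y' t'

/-- **E2 — `TerminalEmber` (size L; THE LINE'S LOAD-BEARING LEMMA; no wall; `A`-free): a terminal hot event
leaves an EMBER.**  There is an absolute `ε₀ > 0` (the ε-regularity regime; v1.1) such that for
`0 < ε ≤ ε₀`, `M ≥ 1` there are an aperture `K = K(ε,M) ≥ 1`, a deposit `c = c(ε,M) > 0` and a room factor
`Λ = Λ(ε,M) ≥ 1`: in the crux frame with virtual rate `M`, an ε-hot event `(y,t)`, `t ≤ t₁ ∈ (0,T]`, with room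
`Λ(T'−t) ≤ t` (so that I1 applies at the scales `≤ √Λ·σ` the mechanism uses), that is `K`-terminal up to
`t₁` has `c ≤ ∫_{B(y, K√(T'−t))} |u(t₁)|³`.  Mechanism, `σ := √(T'−t)`: (a) REGULAR BOX — on
`B(y,(4K−1)σ) × (t−σ², t₁]`, `|u| ≤ M₁(M)/σ` (clock `≥ σ√3/4`: the rate; below: every point is ε-cold by
terminality, and pointwise coldness ⇒ GKT `(∞,1)` smallness at every scale `≤ σ/4` ⇒ with I1 as seed, CKN ⇒
`|u| ≤ C(M)/σ`), derivatives by interior smoothing on `(t−σ²/2, t₁]`; (b) HOT CENTRE IS VORTICAL —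
`|u(t,y)| > ε/σ` and `|∇u(t)| ≤ M₁²/σ²` give a blob; were `‖ω(t)‖_{L²(B(y,Γ₂σ))}` below `δ(M)σ^{-1/2}`, `u(t)`
would be harmonic up to that error on `B(y,Γ₂σ)` and `|u(y)|² ≤ ⨍_{B(y,Γ₂σ)}|u|²` would contradict I1's SLICE
ENERGY `∫_{B(y,ρ)}|u(t)|² ≤ C(M)ρ` at `ρ = Γ₂(M)σ` (STREAM EXCLUSION — by the rate alone, no `A`); (c) COST
OF SILENCING — in a regular box of thickness `Kσ` and time span `≤ 2σ²` the vorticity equation is LINEAR in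
`ω` with coefficients `|u| ≤ M₁/σ`, `|∇u| ≤ M₁²/σ²`; driving the centre's enstrophy from `δ` below `c₂` by
time `t₁` requires lateral influence, attenuated by `e^{-cK²}` across the box while the box holds only
`|ω| ≤ M₁²/σ²`: impossible once `e^{cK²} > M₁² e^{CM₁²}/δ`, i.e. for `K ≥ K(M)` [Carleman / unique
continuation: Tao 2021 Prop. 4.3 (second Carleman inequality) chained over `≤ 10³C₀M₁²` windows,
corpus:paper:tao2021-quantitative-bounds-critically-bounded-solutions-navier-stokes p.32; Escauriaza–Fernández–
Vessella two-sphere one-cylinder / doubling, arXiv:math/0611462 Thm 2–3; Escauriaza–Seregin–Šverák backward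
uniqueness class]; pressure does not enter (vorticity formulation); (d) `‖ω(t₁)‖_{L²(B(y,Kσ/2))} ≥ c₂σ^{-1/2}`
with `|∇ω(t₁)| ≤ M₁³/σ³` yields a point value `≥ c₃/σ²`, hence circulation, hence `|u(t₁)| ≥ c₄/σ` on a ball
of radius `c₅σ`: cube `≥ c(M,ε)`.  Why it might fail: step (c) with coefficient × span `≈ M₁² ≫ 1` is not
verbatim in print — Tao's Prop. 4.3 normalises the coefficients small against the span ((4.4)), so one
chains it over `O(M₁²)` short windows, re-seeding each window by time-continuity in the regular box; the
losses compound to a tower in `M` but stay positive.  A clean «interior cost of null-control for heat with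
bounded drift in a thick box» statement is the honest missing lemma — LINEAR and bounded-coefficient (no
Type-I criticality, no small constant): the DSS wall does not reach it.  Killed by: a smooth Type-I family
with a terminal ε-hot event whose box cube at `t₁` tends to `0` for every fixed `K`. -/
def TerminalEmber : Prop :=
  ∃ ε₀ : ℝ, 0 < ε₀ ∧ ∀ ε M : ℝ, 0 < ε → ε ≤ ε₀ → 1 ≤ M → ∃ K c Λ : ℝ, 1 ≤ K ∧ 0 < c ∧ 1 ≤ Λ ∧
    ∀ (T τ : ℝ) (u : ℝ → E3 → E3) (p : ℝ → E3 → ℝ),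
      (IsClassicalNSSolutionOn (Icc 0 T) 1 0 u p ∧
          ∀ m : ℕ, ∃ C : NNReal, ∀ t ∈ Icc 0 T, eLpNorm (iteratedFDeriv ℝ m (u t)) 2 volume ≤ C) →
        0 < τ →
        (∀ t ∈ Icc 0 T, ∀ x : E3, ‖u t x‖ ≤ M * (T + τ - t) ^ (-(1 / 2 : ℝ))) →
        ∀ (t₁ : ℝ) (y : E3) (t : ℝ), t₁ ∈ Ioc 0 T → t ≤ t₁ → Λ * (T + τ - t) ≤ t →
          Hot ε (T + τ) u y t → Terminal K ε (T + τ) t₁ u y t →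
          ENNReal.ofReal c ≤ ∫⁻ x in ball y (K * Real.sqrt (T + τ - t)), ‖u t₁ x‖ₑ ^ (3 : ℝ)

/-! ## §S  Box bounds: the `C²` box bound of `silencing_cost` (verbatim) and the SHARP box bound of this line -/

/-- **`C²` BOX BOUND at scale `σ`**: on the time set `S` and the ball `B(y,ρ)` the velocity and its first two
spatial derivatives obey the scale-`σ` bounds `‖∇ʲu(s)‖ ≤ M₁ σ^{-(j+1)}`, `j ≤ 2`. -/
def BoxBound (M₁ σ : ℝ) (u : ℝ → E3 → E3) (y : E3) (S : Set ℝ) (ρ : ℝ) : Prop :=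
  ∀ s ∈ S, ∀ x ∈ ball y ρ, ∀ j : ℕ, j ≤ 2 →
    ‖iteratedFDeriv ℝ j (u s) x‖ ≤ M₁ * σ ^ (-((j : ℝ) + 1))

theorem boxBound_mono {M₁ σ : ℝ} {u : ℝ → E3 → E3} {y : E3} {S : Set ℝ} {ρ ρ' : ℝ}
    (h : BoxBound M₁ σ u y S ρ) (hρ : ρ' ≤ ρ) : BoxBound M₁ σ u y S ρ' :=
  fun s hs x hx j hj => h s hs x (ball_subset_ball hρ hx) j hj

/-- **SHARP BOX BOUND at scale `σ`** (this line's class; v1.1 = one order higher than v1, so that L♯2's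
limit lands in the tree's class `C¹₂`): on `S × B(y,ρ)` the velocity has the scale-`σ` bounds
`‖∇ʲu(s,x)‖ ≤ M₁σ^{-(j+1)}` for ALL `j ≤ 6`, and `u`, `∇u`, `∇²u` have a scale-`σ` `γ`-HÖLDER MODULUS IN TIME
`‖∇ⁱu(s,x) − ∇ⁱu(s',x)‖ ≤ M₁σ^{-(i+1)}(|s−s'|/σ²)^γ` (`i ≤ 2`) with an exponent `γ > 0` (the pressure argument of Sa♯ gives `γ = ⅓` — `∂ₜu ∈ L^∞ + L^{3/2}_t L^∞_x`: `Δu − u·∇u` is bounded and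
the harmonic part of the pressure gradient is in `L^{3/2}_t L^∞_x` by the I1 pressure bound; parabolic
ε-regularity [Seregin LN Lemma 6.1, p.90] gives some Hölder exponent directly; ANY `γ > 0` serves L♯2). -/
def SharpBoxBound (M₁ γ σ : ℝ) (u : ℝ → E3 → E3) (y : E3) (S : Set ℝ) (ρ : ℝ) : Prop :=
  (∀ s ∈ S, ∀ x ∈ ball y ρ, ∀ j : ℕ, j ≤ 6 →
    ‖iteratedFDeriv ℝ j (u s) x‖ ≤ M₁ * σ ^ (-((j : ℝ) + 1))) ∧
  (∀ s ∈ S, ∀ s' ∈ S, ∀ x ∈ ball y ρ,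
    ‖u s x - u s' x‖ ≤ M₁ * σ ^ (-(1 : ℝ)) * (|s - s'| / σ ^ 2) ^ γ ∧
    ‖fderiv ℝ (u s) x - fderiv ℝ (u s') x‖ ≤ M₁ * σ ^ (-(2 : ℝ)) * (|s - s'| / σ ^ 2) ^ γ ∧
    ‖iteratedFDeriv ℝ 2 (u s) x - iteratedFDeriv ℝ 2 (u s') x‖ ≤
      M₁ * σ ^ (-(3 : ℝ)) * (|s - s'| / σ ^ 2) ^ γ)

theorem SharpBoxBound.boxBound {M₁ γ σ : ℝ} {u : ℝ → E3 → E3} {y : E3} {S : Set ℝ} {ρ : ℝ}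
    (h : SharpBoxBound M₁ γ σ u y S ρ) : BoxBound M₁ σ u y S ρ :=
  fun s hs x hx j hj => h.1 s hs x hx j (hj.trans (by norm_num))

theorem sharpBoxBound_mono {M₁ γ σ : ℝ} {u : ℝ → E3 → E3} {y : E3} {S : Set ℝ} {ρ ρ' : ℝ}
    (h : SharpBoxBound M₁ γ σ u y S ρ) (hρ : ρ' ≤ ρ) : SharpBoxBound M₁ γ σ u y S ρ' :=
  ⟨fun s hs x hx j hj => h.1 s hs x (ball_subset_ball hρ hx) j hj,
    fun s hs s' hs' x hx => h.2 s hs s' hs' x (ball_subset_ball hρ hx)⟩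

/-- **Sa♯ — `SharpAftermath` (size M–L; PUBLISHED MECHANISMS + the tree's PROVED I1; `A`-free; replaces Sa
`RegularAftermath` of `silencing_cost`, whose conclusion it strengthens from the `C²` box bound to the SHARP box
bound).**  There is an absolute `ε₀ > 0` such that for `0 < ε ≤ ε₀`, `M ≥ 1` there is `M₁ = M₁(ε,M) ≥ 1`,
INDEPENDENT of the aperture, with: in the crux frame with virtual rate `M`, for every `K ≥ 1`, an ε-hot event
`(y,t)` that is `K`-terminal up to `t₁` has the sharp box bound at scale `σ = √(T'−t)` on
`[t,t₁] × B(y,2Kσ)`.  Mechanism — spatial part exactly as Sa (rate where the clock is `≥ σ²/8`; terminal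
COLDNESS + Gustafson–Kang–Tsai `(∞,1)` ε-regularity seeded by I1 where it is not), upgraded from `j ≤ 2` to
`j ≤ 6` by higher interior regularity (Serrin 1962; Ladyzhenskaya–Seregin 1999 / Seregin LN Lemma 6.1 + Remark
6.1, p.90: near a regular point `∇^{k−1}u` is Hölder continuous IN SPACE–TIME for every `k` — which is ALSO the
printed source of the time moduli of `u, ∇u, ∇²u`); temporal part, quantitatively: at a point `x₀` of the box apply I1
(`UniformScaledEnergy`, PROVED: `Theorems/…StubUniformScaledEnergy.lean`) at CENTRE `x₀` and SCALE `σ`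
(`σ² ≤ t` is the hot event's room) — its third clause bounds `σ⁻²∫∫_{Q_σ(x₀)}|p − (p)_σ|^{3/2} ≤ C(M)`, so the
harmonic part `h` of `p − (p)_σ` in `B(x₀,σ)` has `∇h, ∇²h ∈ L^{3/2}_t L^∞(B(x₀,σ/2))` with scale-covariant
norm `C(M)`, while the local part of the pressure and `Δu − u·∇u` are bounded by the spatial bounds; hence
`∂ₜ∇ⁱu ∈ L^∞ + L^{3/2}_t L^∞_x` (`i ≤ 2`; interior harmonic estimates control EVERY `∇ⁱh`) and `⅓`-Hölder
moduli follow (`W^{1,3/2} ⊂ C^{0,1/3}` in time; the statement asks for SOME `γ > 0`), with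
constants depending on `M` only — NOT on `K`.  Why it might fail: not as mathematics (every step in print; I1
in the tree); porting cost M–L (quantitative ε-regularity with explicit seed, as for Sa, plus the local
pressure decomposition).  Sources: arXiv:math/0607114 Thm 1.1; [CaffarelliKohnNirenberg1982] Prop. 1–2;
Serrin, ARMA 9 (1962); Ladyzhenskaya–Seregin, J. Math. Fluid Mech. 1 (1999) Thms 1.1–1.2; Seregin, Lecture
Notes (2014) Ch. 6 [corpus:book:seregin2014-lecture-notes-regularity-theory-navier-stokes-equations];
I1 = `ThinCascade.stub_uniformScaledEnergy` (tree, proved). -/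
def SharpAftermath : Prop :=
  ∃ ε₀ : ℝ, 0 < ε₀ ∧ ∀ ε M : ℝ, 0 < ε → ε ≤ ε₀ → 1 ≤ M → ∃ M₁ γ : ℝ, 1 ≤ M₁ ∧ 0 < γ ∧ ∀ K : ℝ, 1 ≤ K →
    ∀ (T τ : ℝ) (u : ℝ → E3 → E3) (p : ℝ → E3 → ℝ),
      (IsClassicalNSSolutionOn (Icc 0 T) 1 0 u p ∧
          ∀ m : ℕ, ∃ C : NNReal, ∀ t ∈ Icc 0 T, eLpNorm (iteratedFDeriv ℝ m (u t)) 2 volume ≤ C) →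
        0 < τ →
        (∀ t ∈ Icc 0 T, ∀ x : E3, ‖u t x‖ ≤ M * (T + τ - t) ^ (-(1 / 2 : ℝ))) →
        ∀ (t₁ : ℝ) (y : E3) (t : ℝ), t₁ ∈ Ioc 0 T → t ≤ t₁ →
          Hot ε (T + τ) u y t → Terminal K ε (T + τ) t₁ u y t →
          SharpBoxBound M₁ γ (Real.sqrt (T + τ - t)) u y (Icc t t₁) (2 * K * Real.sqrt (T + τ - t))

/-- **Sb — `VorticalCentre` (size M; ELEMENTARY, time-independent; the STREAM EXCLUSION).**  For `ε > 0`,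
`M₁ ≥ 1` and any energy constant `C₀` there are `Γ₂ = Γ₂(ε,C₀) ≥ 1` and `δ = δ(ε,M₁) > 0`: a `C²`
divergence-free field `v` on `ℝ³` with the scale-`σ` `C²` bound on `B(y,σ)`, slice energy
`∫_{B(y,Γ₂σ)}|v|² ≤ C₀Γ₂σ` and a HOT CENTRE `σ|v(y)| > ε` has enstrophy `∫_{B(y,Γ₂σ)}|curl v|² ≥ δ/σ`.
Mechanism (σ = 1): local Biot–Savart/Helmholtz on the ball `B = B(y,Γ₂)` (tree:
`Literature/Analysis/FluidPDE/LocalBiotSavartHelmholtz.lean`): `v = BS_B[ω] + H`, `H` harmonic in `B`;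
`|BS_B[ω](y)| ≤ CρM₁ + Cρ^{-1/2}‖ω‖_{L²(B)}` (near field `|ω| ≤ 2M₁` on `B(y,ρ)`, `ρ ≤ 1`; far field by
Cauchy–Schwarz); `|H(y)| ≤ (⨍_{B(y,Γ₂/2)}|H|²)^{1/2} ≤ C√C₀/Γ₂ + CΓ₂^{-1/2}‖ω‖_{L²(B)}` (mean value; energy;
Young for `BS_B`); with `Γ₂ = max(1,4C√C₀/ε)` and `ρ = ε/(4CM₁)` the hot centre forces
`‖ω‖²_{L²(B)} ≥ ε³/(64C³M₁) =: δ`.  A constant stream `v ≡ c`, `|c| > ε`, is excluded by the energy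
hypothesis once `Γ₂² > 3C₀/(4πε²)` — this is where I1 (not `A`) excludes streams.  Why it might fail: not as
mathematics (explicit vector calculus); porting cost of the local Helmholtz decomposition with constants.
Sources: Majda–Bertozzi §2.4 (local Biot–Savart); tree `LocalBiotSavartHelmholtz.lean`. -/
def VorticalCentre : Prop :=
  ∀ ε M₁ C₀ : ℝ, 0 < ε → 1 ≤ M₁ → ∃ Γ₂ δ : ℝ, 1 ≤ Γ₂ ∧ 0 < δ ∧
    ∀ (v : E3 → E3) (y : E3) (σ : ℝ), 0 < σ → ContDiff ℝ 2 v → VectorCalculus.IsDivFree v →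
      (∀ x ∈ ball y σ, ∀ j : ℕ, j ≤ 2 → ‖iteratedFDeriv ℝ j v x‖ ≤ M₁ * σ ^ (-((j : ℝ) + 1))) →
      (∫⁻ x in ball y (Γ₂ * σ), ENNReal.ofReal (‖v x‖ ^ 2) ≤ ENNReal.ofReal (C₀ * (Γ₂ * σ))) →
      ε < σ * ‖v y‖ →
      ENNReal.ofReal (δ / σ) ≤ ∫⁻ x in ball y (Γ₂ * σ), ‖curl v x‖ₑ ^ 2

/-! ## §D  The LINEAR DRIFT–STRETCH CLASS (this line's lever) and its silencing cost -/

/-- **The drift–stretch class at scale `σ` on the box `S × B(y,ρ)`**: a pair of jointly smooth fields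
`(ω, v)` on the slab `S × ℝ³` such that ON THE BOX `ω` has the scale-`σ` bounds `‖∇ʲω‖ ≤ Bσ^{-(j+2)}`
(`j ≤ 5`), the coefficient `v` has `‖∇ʲv‖ ≤ Bσ^{-(j+1)}` (`j ≤ 4`) and the `γ`-Hölder time moduli of `v, ∇v, ∇²v`
of the sharp box bound (v1.1: one order higher than v1 throughout), and `ω` solves the LINEAR drift–stretch (vorticity-transport) equation
`∂ₛω = Δω + (ω·∇)v − (v·∇)ω` pointwise (`(ω·∇)v = Dv·ω = fderiv v x (ω x)`; one-sided time derivative within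
`S`).  No Navier–Stokes object, no pressure, no rate, no `curl`, no divergence constraint: LINEAR in `ω` with a
smooth-bounded, time-Hölder coefficient.  For `v = u`, `ω = curl u` this is the vorticity equation. -/
def DriftStretchBox (B γ σ : ℝ) (ω v : ℝ → E3 → E3) (y : E3) (S : Set ℝ) (ρ : ℝ) : Prop :=
  IsSmoothSpaceTimeOn S ω ∧ IsSmoothSpaceTimeOn S v ∧
  ∀ s ∈ S, ∀ x ∈ ball y ρ,
    (∀ j : ℕ, j ≤ 5 → ‖iteratedFDeriv ℝ j (ω s) x‖ ≤ B * σ ^ (-((j : ℝ) + 2))) ∧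
    (∀ j : ℕ, j ≤ 4 → ‖iteratedFDeriv ℝ j (v s) x‖ ≤ B * σ ^ (-((j : ℝ) + 1))) ∧
    (∀ s' ∈ S, ‖v s x - v s' x‖ ≤ B * σ ^ (-(1 : ℝ)) * (|s - s'| / σ ^ 2) ^ γ ∧
      ‖fderiv ℝ (v s) x - fderiv ℝ (v s') x‖ ≤ B * σ ^ (-(2 : ℝ)) * (|s - s'| / σ ^ 2) ^ γ ∧
      ‖iteratedFDeriv ℝ 2 (v s) x - iteratedFDeriv ℝ 2 (v s') x‖ ≤
        B * σ ^ (-(3 : ℝ)) * (|s - s'| / σ ^ 2) ^ γ) ∧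
    timeDerivWithin S ω s x = (Δ (ω s)) x + fderiv ℝ (v s) x (ω s x) - fderiv ℝ (ω s) x (v s x)

/-- **Sv♯ — `VorticityTransport` (size M; CALCULUS + the tree's PROVED vorticity formulation; replaces Sv).**
For `M₁ ≥ 1` there is `B = B(M₁) ≥ 1` (`B = 8M₁` will do): a classical solution on `[0,T]` with the SHARP box
bound at scale `σ` on `[t,t₁] × B(y,ρ)` (`0 ≤ t < t₁ ≤ T`) gives the pair `(curl u, u)` in the drift–stretch
class on the same box: joint smoothness (`smooth_velocity`, curl of a jointly smooth field), `‖∇ʲ curl u‖ ≤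
2√3‖∇^{j+1}u‖ ≤ Bσ^{-(j+2)}` (`j ≤ 5` from `j+1 ≤ 6`), the three moduli forwarded, and the vorticity equation
`∂ₛω = Δω + (ω·∇)u − (u·∇)ω` — the tree's PROVED `IsClassicalNSSolutionOn.isVorticitySolutionOn_Icc`
(`VorticityEquation.lean`; Majda–Bertozzi Prop. 2.21), with the time derivative within `[t,t₁]` equal to the
one within `[0,T]` (`IsSmoothSpaceTimeOn.timeDerivWithin_eq_of_subset`).  Why it might fail: it cannot in
substance; Lean work = matching the tree's `IsVorticitySolutionOn` form with the `fderiv` form used here and the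
`iteratedFDeriv` bound for `curl`.  Sources: Majda–Bertozzi §2.4; tree `VorticityEquation.lean`. -/
def VorticityTransport : Prop :=
  ∀ M₁ γ : ℝ, 1 ≤ M₁ → 0 < γ → ∃ B : ℝ, 1 ≤ B ∧
    ∀ (T : ℝ) (u : ℝ → E3 → E3) (p : ℝ → E3 → ℝ), IsClassicalNSSolutionOn (Icc 0 T) 1 0 u p →
    ∀ (y : E3) (σ ρ t t₁ : ℝ), 0 < σ → 0 ≤ t → t < t₁ → t₁ ≤ T →
      SharpBoxBound M₁ γ σ u y (Icc t t₁) ρ →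
      DriftStretchBox B γ σ (fun s => curl (u s)) u y (Icc t t₁) ρ

/-- **Sc″ — `DriftStretchSilencingCost` (the silencing cost IN THE LINEAR DRIFT–STRETCH CLASS; DERIVED below
from L♯1 + L♯2 + the tree's PROVED ESS chain — not a stub).**  For `B ≥ 1`, `δ > 0`, `Γ₂ ≥ 1` there are `K ≥ Γ₂` and
`c ∈ (0,δ]`: a pair `(ω,v)` in the drift–stretch class at scale `σ` on `[t,t₁] × B(y,2Kσ)` (`t < t₁ ≤ t + σ²`)
with centre mass `∫_{B(y,Γ₂σ)}|ω(t)|² ≥ δ/σ` keeps `∫_{B(y,Kσ)}|ω(t₁)|² ≥ c/σ`.  The analogue of Sc′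
`ThickBoxSilencingCost` of `silencing_cost`/`limit_silence` with the INEQUALITY replaced by the EQUATION with a
regular coefficient — weaker hypothesis-wise than nothing (it asks more of the data), and that is the point:
its failing families have limits in the tree's backward-uniqueness class `C¹₂`. -/
def DriftStretchSilencingCost : Prop :=
  ∀ B γ δ Γ₂ : ℝ, 1 ≤ B → 0 < γ → 0 < δ → 1 ≤ Γ₂ → ∃ K c : ℝ, Γ₂ ≤ K ∧ 0 < c ∧ c ≤ δ ∧
    ∀ (ω v : ℝ → E3 → E3) (y : E3) (σ t t₁ : ℝ), 0 < σ → t < t₁ → t₁ ≤ t + σ ^ 2 →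
      DriftStretchBox B γ σ ω v y (Icc t t₁) (2 * K * σ) →
      ENNReal.ofReal (δ / σ) ≤ ∫⁻ x in ball y (Γ₂ * σ), ‖ω t x‖ₑ ^ 2 →
      ENNReal.ofReal (c / σ) ≤ ∫⁻ x in ball y (K * σ), ‖ω t₁ x‖ₑ ^ 2

/-- **Sc♯ — `SharpEnstrophyPersistence` (DERIVED: Sv♯ + Sc″; replaces Sc `EnstrophyPersistence`, same
conclusion under the SHARP box bound).** -/
def SharpEnstrophyPersistence : Prop :=
  ∀ M₁ γ δ Γ₂ : ℝ, 1 ≤ M₁ → 0 < γ → 0 < δ → 1 ≤ Γ₂ → ∃ K c : ℝ, Γ₂ ≤ K ∧ 0 < c ∧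
    ∀ (T : ℝ) (u : ℝ → E3 → E3) (p : ℝ → E3 → ℝ),
      IsClassicalNSSolutionOn (Icc 0 T) 1 0 u p →
      ∀ (y : E3) (σ t t₁ : ℝ), 0 < σ → 0 ≤ t → t ≤ t₁ → t₁ ≤ T → t₁ ≤ t + σ ^ 2 →
        SharpBoxBound M₁ γ σ u y (Icc t t₁) (2 * K * σ) →
        ENNReal.ofReal (δ / σ) ≤ ∫⁻ x in ball y (Γ₂ * σ), ‖curl (u t) x‖ₑ ^ 2 →
        ENNReal.ofReal (c / σ) ≤ ∫⁻ x in ball y (K * σ), ‖curl (u t₁) x‖ₑ ^ 2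

/-- **Sd — `EmberReadout` (size S–M; ELEMENTARY).**  For `K ≥ 1`, `M₁ ≥ 1`, `c > 0` there is
`c' = c'(K,M₁,c) > 0`: a `C²` field with the scale-`σ` `C²` bound on `B(y,2Kσ)` and enstrophy
`∫_{B(y,Kσ)}|curl v|² ≥ c/σ` has cube `∫_{B(y,2Kσ)}|v|³ ≥ c'`.  Mechanism (σ = 1, Taylor): a point
`x* ∈ B_K` with `|curl v(x*)| ≥ (c/|B_K|)^{1/2}`, so `‖Dv(x*)‖ ≥ g := ½(c/|B_K|)^{1/2}` along a unit vector
`e`; with `‖D²v‖ ≤ M₁`, `|v(x*+he) − v(x*)| ≥ ¾hg` for `h = g/(2M₁)`, so `|v| ≥ w := 3g²/(16M₁)` at `x*` or at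
`x*+he`, hence `|v| ≥ w/2` on a ball of radius `w/(2M₁)` inside `B_{2K}`: cube `≥ (w/2)³·(4π/3)(w/(2M₁))³`.
Why it might fail: it cannot (explicit calculus); listed as a stub only because it is a separate `M`-sized
formal lemma (`iteratedFDeriv` ↔ `fderiv`, mean value, measure of a ball).  Sources: elementary.
**v1.2: PROVED below (`emberReadout_holds`); no longer a stub.** -/
def EmberReadout : Prop :=
  ∀ K M₁ c : ℝ, 1 ≤ K → 1 ≤ M₁ → 0 < c → ∃ c' : ℝ, 0 < c' ∧
    ∀ (v : E3 → E3) (y : E3) (σ : ℝ), 0 < σ → ContDiff ℝ 2 v →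
      (∀ x ∈ ball y (2 * K * σ), ∀ j : ℕ, j ≤ 2 →
        ‖iteratedFDeriv ℝ j v x‖ ≤ M₁ * σ ^ (-((j : ℝ) + 1))) →
      ENNReal.ofReal (c / σ) ≤ ∫⁻ x in ball y (K * σ), ‖curl v x‖ₑ ^ 2 →
      ENNReal.ofReal c' ≤ ∫⁻ x in ball y (2 * K * σ), ‖v x‖ₑ ^ (3 : ℝ)

/-! ## §W  The `C¹₂` backward-vanishing witness and ITS UNCONDITIONAL EXCLUSION BY THE TREE'S PROVED ESS CHAIN -/

/-- **`SmoothVanishingWitness`** (v1.1: class `C¹₂`) — the rigid object of the smooth route, NORMALISED (unit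
time span, amplitude `≤ 1`): a vector field `ω : ℝ → ℝ³ → ℝ³`, globally continuous, jointly `C¹` on the open
slab `(0,1) × ℝ³` WITH JOINTLY `C¹` SPATIAL GRADIENT (the clause `∀ e', (s,x) ↦ D(ω s)(x) e' ∈ C¹` — the
tree's class `C¹₂` of `Carleman.backwardUniqueness_uncurried_c12`; it costs L♯2 one more derivative of the
failing family, supplied by Sa♯/Sv♯ v1.1), with `C²` slices, bounded gradient / time derivative / Hessian on
the slab, satisfying the FORWARD caloric inequality `|∂ₛω − Δω| ≤ B(|ω| + |∇ω|)` pointwise on the slab,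
vanishing identically at the END time `s = 1` and not identically at `s = 0`. -/
def SmoothVanishingWitness : Prop :=
  ∃ (B : ℝ) (ω : ℝ → E3 → E3), 0 ≤ B ∧
    Continuous (uncurry ω) ∧
    ContDiffOn ℝ 1 (uncurry ω) (Ioo (0 : ℝ) 1 ×ˢ (univ : Set E3)) ∧
    (∀ e' : E3, ContDiffOn ℝ 1 (fun z : ℝ × E3 => fderiv ℝ (ω z.1) z.2 e') (Ioo (0 : ℝ) 1 ×ˢ (univ : Set E3))) ∧
    (∀ s ∈ Ioo (0 : ℝ) 1, ContDiff ℝ 2 (ω s)) ∧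
    (∀ s ∈ Ioo (0 : ℝ) 1, ∀ x : E3, DifferentiableAt ℝ (fun r => ω r x) s) ∧
    (∀ s : ℝ, ∀ x : E3, ‖ω s x‖ ≤ 1) ∧
    (∀ s ∈ Ioo (0 : ℝ) 1, ∀ x : E3,
      ‖fderiv ℝ (ω s) x‖ ≤ B ∧ ‖timeDeriv ω s x‖ ≤ B ∧ ‖iteratedFDeriv ℝ 2 (ω s) x‖ ≤ B) ∧
    (∀ s ∈ Ioo (0 : ℝ) 1, ∀ x : E3,
      ‖timeDeriv ω s x - (Δ (ω s)) x‖ ≤ B * (‖ω s x‖ + ‖fderiv ℝ (ω s) x‖)) ∧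
    (∀ x : E3, ω 1 x = 0) ∧
    ∃ x : E3, ω 0 x ≠ 0

theorem enorm_sq_le_ofReal {V : Type*} [NormedAddCommGroup V] {v : V} {b : ℝ} (hv : ‖v‖ ≤ b) :
    ‖v‖ₑ ^ 2 ≤ ENNReal.ofReal (b ^ 2) := by
  have hb : 0 ≤ b := (norm_nonneg v).trans hv
  rw [← ofReal_norm, ← ENNReal.ofReal_pow (norm_nonneg _)]
  exact ENNReal.ofReal_le_ofReal (pow_le_pow_left₀ (norm_nonneg _) hv 2)

/-- DICTIONARY (the `C¹₂` variant of the tree's `Carleman.lap_uncurry`, which asks joint `C²`): at a point of an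
open set where the uncurried field is `C¹`, every slice-gradient map `(s,x) ↦ D(ω s)(x) e'` is differentiable
and the slice is `C²`, the frame Laplacian `Carleman.lap` of the uncurried field is Mathlib's Laplacian of the
slice. -/
theorem lap_uncurry_c12 {ω : ℝ → E3 → E3} {O : Set (ℝ × E3)} (hO : IsOpen O) {s : ℝ} {x : E3}
    (hz : (s, x) ∈ O) (h1 : ContDiffOn ℝ 1 (uncurry ω) O)
    (hG : ∀ e' : E3, DifferentiableAt ℝ (fun z : ℝ × E3 => fderiv ℝ (ω z.1) z.2 e') (s, x))
    (h2 : ContDiff ℝ 2 (ω s)) :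
    Carleman.lap (uncurry ω) (s, x) = (Δ (ω s)) x := by
  have hd : ∀ z ∈ O, DifferentiableAt ℝ (uncurry ω) z := fun z hz' =>
    (h1.differentiableOn one_ne_zero).differentiableAt (hO.mem_nhds hz')
  have hdxdx : ∀ e e' : E3, Carleman.dx e (Carleman.dx e' (uncurry ω)) (s, x) =
      fderiv ℝ (fun y => fderiv ℝ (ω s) y e') x e := by
    intro e e'
    have hev : Carleman.dx e' (uncurry ω) =ᶠ[𝓝 ((s, x) : ℝ × E3)]
        fun z : ℝ × E3 => fderiv ℝ (ω z.1) z.2 e' := by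
      filter_upwards [hO.mem_nhds hz] with z hz'
      obtain ⟨r, y⟩ := z
      exact Carleman.dx_uncurry (hd _ hz') e'
    rw [Carleman.dx_apply, hev.fderiv_eq]
    exact Carleman.fderiv_apply_zero_eq_fderiv_slice (hG e') e
  rw [InnerProductSpace.laplacian_eq_iteratedFDeriv_stdOrthonormalBasis]
  simp only [Carleman.lap]
  refine Finset.sum_congr rfl fun i _ => ?_
  rw [hdxdx, iteratedFDeriv_two_apply]
  simp only [Matrix.cons_val_zero, Matrix.cons_val_one]
  have hd2 : DifferentiableAt ℝ (fderiv ℝ (ω s)) x :=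
    ((h2.fderiv_right (m := 1) le_rfl).differentiable one_ne_zero).differentiableAt
  rw [fderiv_clm_apply hd2 (differentiableAt_const _)]
  simp

/-- **KERNEL (stage 1, v1.1 — UNCONDITIONAL): the tree's PROVED ESS chain excludes `C¹₂` backward-vanishing
witnesses.**  Time reversal `u := U ∘ A`, `U = uncurry ω`, `A = stAffine (−1) 1 1 0 : (s,y) ↦ (1 − s, y)`, turns
the forward inequality into the backward one `|∂ₜu + Δu| ≤ B(|u| + |∇u|)` of Seregin 2014 Thm 3.5 / ESS 2003
Thm 5.1 on every `(0,1) × {0 < ⟪x,e⟫}`, with `u(0,·) = ω(1,·) = 0`, growth `|u| ≤ 1 = e^{0·|x|²}` and `∂ₜu`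
bounded (so square integrable on bounded sets); the frame data (`Carleman.dt/dx/lap/gradSq`) are read off the
slice data by the tree's dictionary (`Carleman.dt_uncurry`, `dx_uncurry`, `opNorm_fderiv_le_sqrt_gradSq`, and
`lap_uncurry_c12` above) and transported under `A` by the tree's chain rules (`Carleman.dt/lap/gradSq_comp_stAffine`,
`contDiffOn_comp_stAffine`, `contDiffOn_one_dx_comp_stAffine_c12`).  The tree's PROVED
`Carleman.backwardUniqueness_uncurried_c12` with the PROVED unique-continuation input
`uniqueContinuation_input_c12` (= `Carleman.uniqueContinuation_uncurried_c12 3 3`) gives `u ≡ 0` there, i.e.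
`ω s x = 0` for `s ∈ (0,1)`, `x ≠ 0` (`e = x/‖x‖`); continuity finishes (`x = 0`, then `s = 0`), contradicting
`ω(0,·) ≢ 0`.  NO literature fact is assumed. -/
theorem no_smoothVanishingWitness : ¬ SmoothVanishingWitness := by
  rintro ⟨B, ω, hB, hcont, hC1, hC12, hC2, hdiff, hsup, hbd, hineq, hend, x₀, hx₀⟩
  set U : ℝ × E3 → E3 := uncurry ω with hUdef
  set O : Set (ℝ × E3) := Ioo (0 : ℝ) 1 ×ˢ (univ : Set E3) with hOdef
  have hOo : IsOpen O := isOpen_Ioo.prod isOpen_univ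
  have hd : ∀ z ∈ O, DifferentiableAt ℝ U z := fun z hz =>
    (hC1.differentiableOn one_ne_zero).differentiableAt (hOo.mem_nhds hz)
  -- the `C¹₂` clause in the Carleman frame
  have hUx : ∀ e' : E3, ContDiffOn ℝ 1 (Carleman.dx e' U) O := by
    intro e'
    refine (hC12 e').congr ?_
    rintro ⟨r, y⟩ hz
    exact Carleman.dx_uncurry (hd _ hz) e'
  -- the dictionary on the open slab
  have hdtU : ∀ r ∈ Ioo (0 : ℝ) 1, ∀ y : E3, Carleman.dt U (r, y) = timeDeriv ω r y := fun r hr y =>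
    Carleman.dt_uncurry (hd (r, y) ⟨hr, mem_univ _⟩)
  have hlapU : ∀ r ∈ Ioo (0 : ℝ) 1, ∀ y : E3, Carleman.lap U (r, y) = (Δ (ω r)) y := by
    intro r hr y
    have hz : ((r, y) : ℝ × E3) ∈ O := ⟨hr, mem_univ _⟩
    exact lap_uncurry_c12 hOo hz hC1
      (fun e' => ((hC12 e').differentiableOn one_ne_zero).differentiableAt (hOo.mem_nhds hz)) (hC2 r hr)
  have hgradU : ∀ r ∈ Ioo (0 : ℝ) 1, ∀ y : E3,
      ‖fderiv ℝ (ω r) y‖ ≤ Real.sqrt (Carleman.gradSq U (r, y)) := fun r hr y =>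
    Carleman.opNorm_fderiv_le_sqrt_gradSq (hd (r, y) ⟨hr, mem_univ _⟩)
  -- ESS (tree, proved) on every half-space, after the time reversal `A (s, y) = (1 - s, y)`
  have hzero : ∀ e : E3, ‖e‖ = 1 → ∀ s ∈ Ioo (0 : ℝ) 1, ∀ y : E3, 0 < ⟪y, e⟫_ℝ → ω (1 - s) y = 0 := by
    intro e he
    set H : Set E3 := {x : E3 | 0 < ⟪x, e⟫_ℝ} with hH
    set Q : Set (ℝ × E3) := Ioo (0 : ℝ) 1 ×ˢ H with hQ
    set A : ℝ × E3 → ℝ × E3 := stAffine (-1 : ℝ) 1 1 0 with hAdef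
    have hA : ∀ z : ℝ × E3, A z = (1 - z.1, z.2) := by
      intro z
      rw [hAdef]
      refine Prod.ext ?_ ?_
      · show (1 : ℝ) + (-1) * z.1 = 1 - z.1
        ring
      · show (0 : E3) + (1 : ℝ) • z.2 = z.2
        simp
    have hpre : Q ⊆ A ⁻¹' O := by
      intro z hz
      rw [mem_preimage, hA]
      exact ⟨⟨by linarith [hz.1.2], by linarith [hz.1.1]⟩, mem_univ _⟩
    have hrev : ∀ z ∈ Q, 1 - z.1 ∈ Ioo (0 : ℝ) 1 := fun z hz =>
      ⟨by linarith [hz.1.2], by linarith [hz.1.1]⟩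
    -- the reversed field and its frame data
    set u : ℝ × E3 → E3 := fun z => U (A z) with hudef
    have hu1 : ContDiffOn ℝ 1 u Q := (Carleman.contDiffOn_comp_stAffine hC1 (-1) 1 1 0).mono hpre
    have hux : ∀ e' : E3, ContDiffOn ℝ 1 (Carleman.dx e' u) Q := fun e' =>
      (Carleman.contDiffOn_one_dx_comp_stAffine_c12 (show (-1 : ℝ) ≠ 0 by norm_num) one_ne_zero
        hUx 1 0 e').mono hpre
    have hucont : ContinuousOn u (Ico (0 : ℝ) 1 ×ˢ H) := by
      refine Continuous.continuousOn ?_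
      exact hcont.comp (continuous_stAffine (-1 : ℝ) 1 1 0)
    have h0 : ∀ y : E3, 0 < ⟪y, e⟫_ℝ → u (0, y) = 0 := by
      intro y _
      show U (A (0, y)) = 0
      rw [hA]
      simp [hUdef, hend]
    have hdtu : ∀ z, Carleman.dt u z = (-1 : ℝ) • Carleman.dt U (A z) := fun z => by
      rw [hudef, Carleman.dt_comp_stAffine (show (-1 : ℝ) ≠ 0 by norm_num) one_ne_zero]
    have hlapu : ∀ z, Carleman.lap u z = Carleman.lap U (A z) := fun z => by
      rw [hudef, Carleman.lap_comp_stAffine (show (-1 : ℝ) ≠ 0 by norm_num) one_ne_zero, one_pow, one_smul]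
    have hgradu : ∀ z, Carleman.gradSq u z = Carleman.gradSq U (A z) := fun z => by
      rw [hudef, Carleman.gradSq_comp_stAffine (show (-1 : ℝ) ≠ 0 by norm_num) one_ne_zero, one_pow, one_mul]
    -- (hBH) the backward inequality
    have hBH : ∀ z ∈ Q, ‖Carleman.dt u z + Carleman.lap u z‖ ≤
        B * (‖u z‖ + Real.sqrt (Carleman.gradSq u z)) := by
      intro z hz
      have hs := hrev z hz
      rw [hdtu, hlapu, hgradu, show u z = U (A z) from rfl, hA, hdtU (1 - z.1) hs z.2,
        hlapU (1 - z.1) hs z.2]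
      have e1 : (-1 : ℝ) • timeDeriv ω (1 - z.1) z.2 + Δ (ω (1 - z.1)) z.2 =
          -(timeDeriv ω (1 - z.1) z.2 - Δ (ω (1 - z.1)) z.2) := by
        rw [neg_one_smul]; abel
      rw [e1, norm_neg]
      calc ‖timeDeriv ω (1 - z.1) z.2 - Δ (ω (1 - z.1)) z.2‖
          ≤ B * (‖ω (1 - z.1) z.2‖ + ‖fderiv ℝ (ω (1 - z.1)) z.2‖) := hineq _ hs _
        _ ≤ B * (‖U (1 - z.1, z.2)‖ + Real.sqrt (Carleman.gradSq U (1 - z.1, z.2))) :=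
          mul_le_mul_of_nonneg_left (add_le_add (le_of_eq rfl) (hgradU _ hs _)) hB
    -- (hgrowth) `|u| ≤ 1 = e^{0·|x|²}`
    have hgrowth : ∀ z ∈ Q, ‖u z‖ ≤ Real.exp (0 * ‖z.2‖ ^ 2) := by
      intro z _
      rw [zero_mul, Real.exp_zero, show u z = U (A z) from rfl, hA]
      exact hsup _ _
    -- (hH3) `∂ₜu` is bounded, hence square integrable on bounded sets
    have hH3 : ∀ K ⊆ Q, Bornology.IsBounded K → MeasurableSet K →
        ∫⁻ z in K, ‖Carleman.dt u z‖ₑ ^ 2 < ∞ := by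
      intro K hK hKb hKm
      have hle : ∀ z ∈ K, ‖Carleman.dt u z‖ₑ ^ 2 ≤ ENNReal.ofReal (B ^ 2) := by
        intro z hz
        have hs := hrev z (hK hz)
        rw [hdtu, hA, hdtU (1 - z.1) hs z.2, neg_one_smul, enorm_neg]
        exact enorm_sq_le_ofReal (hbd _ hs _).2.1
      calc ∫⁻ z in K, ‖Carleman.dt u z‖ₑ ^ 2 ≤ ∫⁻ _ in K, ENNReal.ofReal (B ^ 2) := setLIntegral_mono' hKm hle
        _ = ENNReal.ofReal (B ^ 2) * volume K := setLIntegral_const _ _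
        _ < ∞ := ENNReal.mul_lt_top ENNReal.ofReal_lt_top hKb.measure_lt_top
    -- the tree's PROVED backward uniqueness in the class `C¹₂`, unique continuation PROVED in the tree
    have hz0 := Carleman.backwardUniqueness_uncurried_c12 (E := E3) (F := E3)
      uniqueContinuation_input_c12 he (c₁ := B) (M := 0) hB le_rfl hu1 hux hucont h0 hBH hgrowth hH3
    intro s hs y hy
    have h : U (A (s, y)) = 0 := hz0 (s, y) ⟨hs, hy⟩
    rw [hA] at h
    simpa [hUdef] using h
  -- hence `ω s x = 0` for `s ∈ (0,1)` and `x ≠ 0`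
  have hvan : ∀ s ∈ Ioo (0 : ℝ) 1, ∀ x : E3, x ≠ 0 → ω s x = 0 := by
    intro s hs x hx
    have hnx : 0 < ‖x‖ := norm_pos_iff.2 hx
    set e : E3 := ‖x‖⁻¹ • x with he
    have hne : ‖e‖ = 1 := by
      rw [he, norm_smul, norm_inv, norm_norm, inv_mul_cancel₀ hnx.ne']
    have hxe : 0 < ⟪x, e⟫_ℝ := by
      rw [he, real_inner_smul_right, real_inner_self_eq_norm_sq]
      have : ‖x‖⁻¹ * ‖x‖ ^ 2 = ‖x‖ := by field_simp
      rw [this]; exact hnx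
    have h := hzero e hne (1 - s) ⟨by linarith [hs.2], by linarith [hs.1]⟩ x hxe
    simpa using h
  -- `x = 0` by spatial continuity
  have hvan' : ∀ s ∈ Ioo (0 : ℝ) 1, ∀ x : E3, ω s x = 0 := by
    intro s hs
    have hcs : Continuous (ω s) :=
      hcont.comp (continuous_const.prodMk continuous_id : Continuous fun x : E3 => (s, x))
    have hEq : (ω s) = fun _ => (0 : E3) := by
      refine Continuous.ext_on (dense_compl_singleton (0 : E3)) hcs continuous_const ?_
      intro x hx
      exact hvan s hs x hx
    intro x
    simpa using congrFun hEq x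
  -- `s = 0` by temporal continuity
  have hct : Continuous (fun r => ω r x₀) :=
    hcont.comp (continuous_id.prodMk continuous_const : Continuous fun r : ℝ => (r, x₀))
  have hclosed : IsClosed {r : ℝ | ω r x₀ = 0} := isClosed_eq hct continuous_const
  have hsub : Ioo (0 : ℝ) 1 ⊆ {r : ℝ | ω r x₀ = 0} := fun r hr => hvan' r hr x₀
  have h0 : (0 : ℝ) ∈ closure (Ioo (0 : ℝ) 1) := by
    rw [closure_Ioo (zero_ne_one' ℝ)]; exact ⟨le_rfl, zero_le_one⟩
  have : (0 : ℝ) ∈ {r : ℝ | ω r x₀ = 0} := (hclosed.closure_subset_iff.2 hsub) h0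
  exact hx₀ this

/-! ## §L  Normalised failing families of the drift–stretch class; the two compactness-side stubs -/

/-- A NORMALISED SMOOTH FAILING FAMILY for `DriftStretchSilencingCost` at constants `(B,δ,Γ₂)`: scale
`σ = 1`, centre `0`, initial time `0`, horizon `s₁ ∈ (0,1]`, aperture `K = Γ₂ + n`, floor missed below
`1/(n+1)`: pairs `(ωₙ,vₙ)` in the drift–stretch class on `[0,s₁] × B(0, 2(Γ₂+n))` with initial centre mass
`≥ δ` on `B(0,Γ₂)` and final mass `< 1/(n+1)` on `B(0,Γ₂+n)`. -/
def SmoothFailingFamily : Prop :=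
  ∃ B γ δ Γ₂ : ℝ, 1 ≤ B ∧ 0 < γ ∧ 0 < δ ∧ 1 ≤ Γ₂ ∧
    ∀ n : ℕ, ∃ (ω v : ℝ → E3 → E3) (s₁ : ℝ), 0 < s₁ ∧ s₁ ≤ 1 ∧
    DriftStretchBox B γ 1 ω v 0 (Icc 0 s₁) (2 * (Γ₂ + n)) ∧
    ENNReal.ofReal δ ≤ ∫⁻ x in ball (0 : E3) Γ₂, ‖ω 0 x‖ₑ ^ 2 ∧
    ∫⁻ x in ball (0 : E3) (Γ₂ + n), ‖ω s₁ x‖ₑ ^ 2 < ENNReal.ofReal (1 / ((n : ℝ) + 1))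

/-- L♯1 statement: NORMALISATION. -/
def SmoothNormalisation : Prop := ¬ DriftStretchSilencingCost → SmoothFailingFamily

/-- L♯2 statement: COMPACTNESS with a limit in the class `C¹₂` (jointly `C¹`, spatial gradient jointly `C¹`). -/
def SmoothLimitStep : Prop := SmoothFailingFamily → SmoothVanishingWitness

/-- **L♯1 (stub, NORMALISATION; S–M, Lean calculus).**  `¬DriftStretchSilencingCost` read at `K := Γ₂ + n`,
`c := min δ (1/(n+1))` gives for every `n` a bad configuration `(ω, v, y, σ, t, t₁)`; the parabolic rescaling
`ω̃ s z := σ² • ω (t + σ²s) (y + σ•z)`, `ṽ s z := σ • v (t + σ²s) (y + σ•z)` on `[0,(t₁−t)/σ²] × ℝ³` is in the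
class at scale `1` with the SAME `B` (`σ^{j+2}‖∇ʲω‖ ≤ B`, `σ^{j+1}‖∇ʲv‖ ≤ B`; moduli: `σ^{i+1}‖∇ⁱv(t+σ²s) −
∇ⁱv(t+σ²s')‖ ≤ σ^{i+1}·Bσ^{-(i+1)}(σ²|s−s'|/σ²)^γ` — the SAME `γ`; the equation scales by `σ⁴` termwise: `∂ₛω̃ = σ⁴∂ₜω`, `Δω̃ = σ⁴Δω`,
`Dṽ(ω̃) = σ⁴Dv(ω)`, `Dω̃(ṽ) = σ⁴Dω(v)`), has initial mass `σ·(δ/σ) = δ` on `B(0,Γ₂)` and final mass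
`< σ·(c/σ) = c ≤ 1/(n+1)` on `B(0,Γ₂+n)`.  Certainly true; chain rules (`fderiv`, `iteratedFDeriv`,
`derivWithin`, `Δ`, `IsSmoothSpaceTimeOn` under affine maps) and `lintegral` under `x ↦ y + σ•x`. -/
theorem stub_smoothNormalisation : SmoothNormalisation := by
  sorry

/-- **L♯2 (stub, COMPACTNESS; M–L bookkeeping — THE analytic step of the line).**  Along a normalised
failing family `(ωₙ,vₙ)` on `[0,sₙ] × B(0,2(Γ₂+n))` (extend constantly in time outside `[0,sₙ]`; pass to
`sₙ → S ∈ [0,1]`): (i) `∂ₛωₙ = Δωₙ + Dvₙ·ωₙ − Dωₙ·vₙ` is bounded (`≤ √3·B + 2B²`), and — differentiating the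
EQUATION in space, which joint smoothness allows — so are `∂ₛ∇ʲωₙ = ∇ʲ(Δωₙ + Dvₙ·ωₙ − Dωₙ·vₙ)` for `j ≤ 3`
(they need `∇⁵ωₙ`, `∇⁴vₙ`: in the v1.1 class); with the spatial bounds, `ωₙ, ∇ωₙ, ∇²ωₙ, ∇³ωₙ` are JOINTLY
EQUICONTINUOUS; `vₙ, ∇vₙ, ∇²vₙ` are jointly equicontinuous by `‖∇^{i+1}vₙ‖ ≤ B` and the three `γ`-Hölder TIME
MODULI (this is where they are used: a coefficient with no time regularity — Serrin's `a(s)∇h` — would make the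
limit equation's right side discontinuous in time); Arzelà–Ascoli + diagonal subsequence: `∇ʲωₙ → ∇ʲω*`
(`j ≤ 3`), `∇ⁱvₙ → ∇ⁱv*` (`i ≤ 2`) locally uniformly on `ℝ × ℝ³`; (ii) hence `∂ₛωₙ → G := Δω* + Dv*·ω* − Dω*·v*`
AND `∂ₛ∇ωₙ = ∇(Δωₙ + Dvₙ·ωₙ − Dωₙ·vₙ) → ∇G` locally uniformly on `(0,S) × ℝ³`, so `ω*` and `∇ω*` are
differentiable in `s` there with the jointly continuous derivatives `G`, `∇G` (uniform limit of derivatives) —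
`ω*` is jointly `C¹` on the open slab, EVERY SLICE-GRADIENT MAP `(s,x) ↦ D(ω* s)(x)e'` IS JOINTLY `C¹` (its
partials `∇²ω*·e'` and `∇G·e'` are continuous: the class `C¹₂` of the tree's backward-uniqueness theorem), the
slices are `C²`, `‖∇ω*‖, ‖∇²ω*‖ ≤ B`, `‖∂ₛω*‖ ≤ √3B + 2B²`, and `‖∂ₛω* − Δω*‖ = ‖Dv*·ω* − Dω*·v*‖ ≤
B(‖ω*‖ + ‖∇ω*‖)` POINTWISE; (iii) `S > 0`:
otherwise `‖ωₙ(sₙ) − ωₙ(0)‖_∞ ≤ (√3B + 2B²)sₙ → 0` on `B(0,Γ₂)`, contradicting initial mass `≥ δ` vs final mass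
`→ 0` (masses of equi-bounded fields on a fixed ball are Lipschitz in the sup distance) — in that case the
family is contradictory and the implication holds trivially; (iv) `ω*(S,·) ≡ 0` (final masses `→ 0` on
exhausting balls + equicontinuity ⇒ locally uniform smallness) and `ω*(0,·) ≢ 0` (`∫_{B(0,Γ₂)}|ω*(0)|² ≥ δ`);
(v) NORMALISE: time `s ↦ s/S` with space `x ↦ x/√S` (`S ≤ 1` keeps every bound `≤ B'` and the inequality
constant `≤ B`) and amplitude `ω ↦ ω / max(1, sup‖ω‖)` (the class is LINEAR): a `SmoothVanishingWitness`.
Why it might fail: bookkeeping only (Arzelà–Ascoli, the one-variable «uniform limit of derivatives» theorem,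
`L²`-vs-sup on balls); every ingredient is in Mathlib or textbook.  No PDE theorem is used. -/
theorem stub_smoothLimitStep : SmoothLimitStep := by
  sorry

/-! ## §K  Kernels (proved) -/

/-- KERNEL 1 (v1.1, unconditional): the drift–stretch silencing cost from normalisation + compactness + the
TREE'S PROVED ESS CHAIN (`no_smoothVanishingWitness`). -/
theorem driftStretchSilencingCost_of (h₁ : SmoothNormalisation) (h₂ : SmoothLimitStep) :
    DriftStretchSilencingCost := by
  by_contra h
  exact no_smoothVanishingWitness (h₂ (h₁ h))

/-- STUB Sa♯ (M–L, published mechanisms + I1): see `SharpAftermath`. -/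
theorem stub_sharpAftermath : SharpAftermath := by
  sorry

/-- STUB Sb (M, elementary; verbatim from `silencing_cost`): see `VorticalCentre`. -/
theorem stub_vorticalCentre : VorticalCentre := by
  sorry

/-- STUB Sv♯ (M, calculus + tree): see `VorticityTransport`. -/
theorem stub_vorticityTransport : VorticityTransport := by
  sorry

/-- `‖curl v x‖ ≤ 4‖Dv(x)‖` (entries of `Dv(x)` are bounded by its operator norm; the same computation as
the `have norm_curl_le` of the tree's `DebrisQuantaRobustDecayQuantumRefutation.lean`). -/
theorem norm_curl_le_four_mul (v : E3 → E3) (x : E3) : ‖curl v x‖ ≤ 4 * ‖fderiv ℝ v x‖ := by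
  have habs : ∀ j i : Fin 3, |fderiv ℝ v x (EuclideanSpace.single j 1) i| ≤ ‖fderiv ℝ v x‖ := by
    intro j i
    have h1 : |fderiv ℝ v x (EuclideanSpace.single j 1) i| ≤
        ‖fderiv ℝ v x (EuclideanSpace.single j 1)‖ := by
      simpa [Real.norm_eq_abs] using PiLp.norm_apply_le (fderiv ℝ v x (EuclideanSpace.single j 1)) i
    have h2 := (fderiv ℝ v x).le_opNorm (EuclideanSpace.single j 1)
    have hs : ‖(EuclideanSpace.single j (1:ℝ) : E3)‖ = 1 := by simp
    rw [hs, mul_one] at h2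
    exact h1.trans h2
  set M := ‖fderiv ℝ v x‖ with hM
  have c0 : curl v x 0 = fderiv ℝ v x (EuclideanSpace.single 1 1) 2 -
      fderiv ℝ v x (EuclideanSpace.single 2 1) 1 := rfl
  have c1 : curl v x 1 = fderiv ℝ v x (EuclideanSpace.single 2 1) 0 -
      fderiv ℝ v x (EuclideanSpace.single 0 1) 2 := rfl
  have c2 : curl v x 2 = fderiv ℝ v x (EuclideanSpace.single 0 1) 1 -
      fderiv ℝ v x (EuclideanSpace.single 1 1) 0 := rfl
  have h0 : |curl v x 0| ≤ 2 * M := by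
    rw [c0]; exact (abs_sub _ _).trans (by linarith [habs 1 2, habs 2 1])
  have h1 : |curl v x 1| ≤ 2 * M := by
    rw [c1]; exact (abs_sub _ _).trans (by linarith [habs 2 0, habs 0 2])
  have h2 : |curl v x 2| ≤ 2 * M := by
    rw [c2]; exact (abs_sub _ _).trans (by linarith [habs 0 1, habs 1 0])
  have hM0 : 0 ≤ M := norm_nonneg _
  have hsq : ‖curl v x‖ ^ 2 ≤ (4 * M) ^ 2 := by
    rw [EuclideanSpace.norm_sq_eq, Fin.sum_univ_three]
    simp only [Real.norm_eq_abs]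
    have e0 := sq_abs (curl v x 0)
    have e1 := sq_abs (curl v x 1)
    have e2 := sq_abs (curl v x 2)
    nlinarith [abs_nonneg (curl v x 0), abs_nonneg (curl v x 1), abs_nonneg (curl v x 2)]
  exact (pow_le_pow_iff_left₀ (norm_nonneg _) (by positivity) two_ne_zero).mp hsq

set_option maxHeartbeats 1600000 in
/-- **Sd `EmberReadout` — PROVED (v1.2)** (elementary: a point of large `|curl v|` from the enstrophy mass, a
unit direction nearly attaining `‖Dv‖`, a second-order Taylor step along it producing a point of large
`|v|`, Lipschitz persistence on a small ball, and the volume of balls in `ℝ³`; all lengths are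
`(K, M₁, c)`-dependent multiples of `σ`, so the constant `c'` is `σ`-free). -/
theorem emberReadout_holds : EmberReadout := by
  intro K M₁ c hK hM₁ hc
  obtain ⟨W, hW, hvol⟩ : ∃ W : ℝ, 0 < W ∧
      ∀ (x : E3) (ρ : ℝ), 0 ≤ ρ → volume (ball x ρ) = ENNReal.ofReal (ρ ^ 3 * W) := by
    refine ⟨√Real.pi ^ 3 / Real.Gamma (3 / 2 + 1),
      div_pos (pow_pos (Real.sqrt_pos.mpr Real.pi_pos) 3) (Real.Gamma_pos_of_pos (by norm_num)),
      fun x ρ hρ => ?_⟩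
    rw [EuclideanSpace.volume_ball, ENNReal.ofReal_mul (pow_nonneg hρ 3), ENNReal.ofReal_pow hρ]
    simp
  have hK0 : 0 < K := by linarith
  have hM0 : 0 < M₁ := by linarith
  set a : ℝ := Real.sqrt (c / (2 * K ^ 3 * W)) with ha_def
  have ha : 0 < a := Real.sqrt_pos.mpr (by positivity)
  have ha2 : a ^ 2 = c / (2 * K ^ 3 * W) := Real.sq_sqrt (by positivity)
  set d : ℝ := a / 8 with hd_def
  have hd : 0 < d := by positivity
  set s₀ : ℝ := min 1 (d / (2 * M₁)) with hs₀_def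
  have hs₀ : 0 < s₀ := lt_min one_pos (by positivity)
  have hs₀1 : s₀ ≤ 1 := min_le_left _ _
  have hs₀d : M₁ * s₀ ≤ d / 2 := by
    have h : s₀ ≤ d / (2 * M₁) := min_le_right _ _
    calc M₁ * s₀ ≤ M₁ * (d / (2 * M₁)) := by gcongr
      _ = d / 2 := by field_simp
  set s₁ : ℝ := s₀ / 2 with hs₁_def
  have hs₁ : 0 < s₁ := by positivity
  have hs₁s₀ : s₁ < s₀ := by rw [hs₁_def]; linarith
  have hs₁1 : s₁ ≤ 1 / 2 := by rw [hs₁_def]; linarith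
  set b : ℝ := s₁ * d / 2 with hb_def
  have hb : 0 < b := by positivity
  set r : ℝ := min (1 / 2) (b / (2 * M₁)) with hr_def
  have hr : 0 < r := lt_min (by norm_num) (by positivity)
  have hr1 : r ≤ 1 / 2 := min_le_left _ _
  have hrb : M₁ * r ≤ b / 2 := by
    have h : r ≤ b / (2 * M₁) := min_le_right _ _
    calc M₁ * r ≤ M₁ * (b / (2 * M₁)) := by gcongr
      _ = b / 2 := by field_simp
  refine ⟨b ^ 3 * r ^ 3 * W / 8, by positivity, ?_⟩
  intro v y σ hσ hv hbd hens
  -- derivative facts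
  have hvd : Differentiable ℝ v := hv.differentiable (by norm_num)
  have hfd : ContDiff ℝ 1 (fderiv ℝ v) := hv.fderiv_right (by norm_num)
  have hfdd : Differentiable ℝ (fderiv ℝ v) := hfd.differentiable (by norm_num)
  -- the three pointwise bounds on the big ball, in inverse-power form
  have hpow : ∀ n : ℕ, σ ^ (-((n : ℝ))) = (σ ^ n)⁻¹ := fun n => by
    rw [Real.rpow_neg hσ.le, Real.rpow_natCast]
  have hB1 : ∀ x ∈ ball y (2 * K * σ), ‖fderiv ℝ v x‖ ≤ M₁ * (σ ^ 2)⁻¹ := by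
    intro x hx
    have h := hbd x hx 1 (by norm_num)
    rw [norm_iteratedFDeriv_one] at h
    have e : σ ^ (-(((1 : ℕ) : ℝ) + 1)) = (σ ^ 2)⁻¹ := by
      rw [show (-(((1 : ℕ) : ℝ) + 1)) = -((2 : ℕ) : ℝ) by norm_num]; exact hpow 2
    rwa [e] at h
  have hB2 : ∀ x ∈ ball y (2 * K * σ), ‖fderiv ℝ (fderiv ℝ v) x‖ ≤ M₁ * (σ ^ 3)⁻¹ := by
    intro x hx
    have h := hbd x hx 2 le_rfl
    rw [← norm_iteratedFDeriv_fderiv, norm_iteratedFDeriv_one] at h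
    have e : σ ^ (-(((2 : ℕ) : ℝ) + 1)) = (σ ^ 3)⁻¹ := by
      rw [show (-(((2 : ℕ) : ℝ) + 1)) = -((3 : ℕ) : ℝ) by norm_num]; exact hpow 3
    rwa [e] at h
  -- Step 1: a point of the inner ball where `|curl v| ≥ a σ⁻²`
  obtain ⟨x₁, hx₁, hcurl⟩ : ∃ x₁ ∈ ball y (K * σ), a * (σ ^ 2)⁻¹ ≤ ‖curl v x₁‖ := by
    by_contra hcon
    push Not at hcon
    have hle : ∫⁻ x in ball y (K * σ), ‖curl v x‖ₑ ^ 2 ≤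
        ENNReal.ofReal ((a * (σ ^ 2)⁻¹) ^ 2) * volume (ball y (K * σ)) := by
      calc ∫⁻ x in ball y (K * σ), ‖curl v x‖ₑ ^ 2
          ≤ ∫⁻ _ in ball y (K * σ), ENNReal.ofReal ((a * (σ ^ 2)⁻¹) ^ 2) :=
            setLIntegral_mono' measurableSet_ball (fun x hx => enorm_sq_le_ofReal (hcon x hx).le)
        _ = _ := setLIntegral_const _ _
    rw [hvol y (K * σ) (by positivity), ← ENNReal.ofReal_mul (by positivity)] at hle
    have hprod : (a * (σ ^ 2)⁻¹) ^ 2 * ((K * σ) ^ 3 * W) = c / (2 * σ) := by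
      rw [mul_pow, ha2]; field_simp
    rw [hprod] at hle
    have hlt : ENNReal.ofReal (c / (2 * σ)) < ENNReal.ofReal (c / σ) := by
      rw [ENNReal.ofReal_lt_ofReal_iff (by positivity)]
      rw [div_lt_div_iff₀ (by positivity) hσ]; nlinarith
    exact absurd (hens.trans hle) (not_le.mpr hlt)
  have hKσ : K * σ ≤ 2 * K * σ := by nlinarith
  have hx₁B : x₁ ∈ ball y (2 * K * σ) := ball_subset_ball hKσ hx₁
  have hx₁n : ‖x₁ - y‖ < K * σ := mem_ball_iff_norm.mp hx₁
  -- Step 2: `‖Dv(x₁)‖ ≥ (a/4) σ⁻²` and a unit direction `e` with `‖Dv(x₁) e‖ ≥ d σ⁻²`, `d = a/8`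
  have hD : a / 4 * (σ ^ 2)⁻¹ ≤ ‖fderiv ℝ v x₁‖ := by
    have h := norm_curl_le_four_mul v x₁; linarith [hcurl]
  obtain ⟨e, he1, hfe⟩ : ∃ e : E3, ‖e‖ = 1 ∧ d * (σ ^ 2)⁻¹ ≤ ‖fderiv ℝ v x₁ e‖ := by
    by_contra hcon
    push Not at hcon
    have hop : ‖fderiv ℝ v x₁‖ ≤ d * (σ ^ 2)⁻¹ := by
      refine ContinuousLinearMap.opNorm_le_bound _ (by positivity) (fun z => ?_)
      by_cases hz : z = 0
      · simp [hz]
      · have hzpos : 0 < ‖z‖ := norm_pos_iff.mpr hz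
        have hz' : ‖z‖ ≠ 0 := hzpos.ne'
        have hu : ‖(‖z‖⁻¹ : ℝ) • z‖ = 1 := by
          rw [norm_smul, norm_inv, norm_norm, inv_mul_cancel₀ hz']
        have h1 := hcon _ hu
        rw [map_smul, norm_smul, norm_inv, norm_norm] at h1
        have h2 := mul_lt_mul_of_pos_left h1 hzpos
        rw [← mul_assoc, mul_inv_cancel₀ hz', one_mul] at h2
        nlinarith [h2]
    have hlt : d * (σ ^ 2)⁻¹ < a / 4 * (σ ^ 2)⁻¹ := by
      apply mul_lt_mul_of_pos_right _ (by positivity); rw [hd_def]; linarith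
    linarith
  -- Step 3: second-order Taylor along `e` — one of `x₁ ± s e`, `s = s₁ σ`, carries `|v| ≥ b σ⁻¹`
  set s : ℝ := s₁ * σ with hs_def
  have hs : 0 < s := by positivity
  have hconvB : Convex ℝ (ball y (2 * K * σ)) := convex_ball _ _
  -- the small ball about x₁ sits inside the big ball
  have hsmall : ball x₁ (s₀ * σ) ⊆ ball y (2 * K * σ) := by
    intro z hz
    rw [mem_ball_iff_norm] at hz ⊢
    have h1 : ‖z - y‖ ≤ ‖z - x₁‖ + ‖x₁ - y‖ := norm_sub_le_norm_sub_add_norm_sub _ _ _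
    have h2 : s₀ * σ ≤ 1 * σ := by gcongr
    nlinarith
  -- `g := v − Dv(x₁)` has small derivative on the small ball
  set f := fderiv ℝ v x₁ with hf_def
  set g : E3 → E3 := fun x => v x - f x with hg_def
  have hgd : ∀ x, DifferentiableAt ℝ g x := fun x => (hvd x).sub (f.differentiableAt)
  have hgf : ∀ z ∈ ball x₁ (s₀ * σ), ‖fderiv ℝ g z‖ ≤ M₁ * (σ ^ 3)⁻¹ * (s₀ * σ) := by
    intro z hz
    have hzB := hsmall hz
    have e1 : fderiv ℝ g z = fderiv ℝ v z - f := by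
      rw [hg_def, show (fun x => v x - f x) = (v - ⇑f) from rfl, fderiv_sub (hvd z) f.differentiableAt,
        ContinuousLinearMap.fderiv]
    rw [e1]
    have hmv := hconvB.norm_image_sub_le_of_norm_fderiv_le (f := fderiv ℝ v) (fun x _ => hfdd x)
      (fun x hx => hB2 x hx) hx₁B hzB
    have hz' : ‖z - x₁‖ ≤ s₀ * σ := (mem_ball_iff_norm.mp hz).le
    calc ‖fderiv ℝ v z - f‖ ≤ M₁ * (σ ^ 3)⁻¹ * ‖z - x₁‖ := hmv
      _ ≤ M₁ * (σ ^ 3)⁻¹ * (s₀ * σ) := by gcongr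
  have hconvS : Convex ℝ (ball x₁ (s₀ * σ)) := convex_ball _ _
  have hx₁S : x₁ ∈ ball x₁ (s₀ * σ) := mem_ball_self (by positivity)
  have hpS : ∀ t : ℝ, |t| = s → x₁ + t • e ∈ ball x₁ (s₀ * σ) := by
    intro t ht
    rw [mem_ball_iff_norm, add_sub_cancel_left, norm_smul, Real.norm_eq_abs, ht, he1, mul_one, hs_def]
    exact mul_lt_mul_of_pos_right hs₁s₀ hσ
  have hTaylor : ∀ t : ℝ, |t| = s → ‖v (x₁ + t • e) - v x₁ - f (t • e)‖ ≤ M₁ * (σ ^ 3)⁻¹ * (s₀ * σ) * s := by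
    intro t ht
    have h := hconvS.norm_image_sub_le_of_norm_fderiv_le (f := g) (fun x _ => hgd x) hgf hx₁S (hpS t ht)
    have e1 : g (x₁ + t • e) - g x₁ = v (x₁ + t • e) - v x₁ - f (t • e) := by
      simp only [hg_def, map_add]; abel
    rw [e1, add_sub_cancel_left, norm_smul, Real.norm_eq_abs, ht, he1, mul_one] at h
    exact h
  have hplus := hTaylor s (abs_of_pos hs)
  have hminus := hTaylor (-s) (by rw [abs_neg, abs_of_pos hs])
  -- the difference `v(x₁ + s e) − v(x₁ − s e)` is large
  have hfe2 : ‖f ((2 * s) • e)‖ = 2 * s * ‖f e‖ := by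
    rw [map_smul, norm_smul, Real.norm_eq_abs, abs_of_pos (by positivity)]
  have hdiff : s₁ * d * σ⁻¹ ≤ ‖v (x₁ + s • e) - v (x₁ + (-s) • e)‖ := by
    set A := v (x₁ + s • e) - v x₁ - f (s • e) with hA
    set B := v (x₁ + (-s) • e) - v x₁ - f ((-s) • e) with hB
    have hf2 : f ((2 * s) • e) = f (s • e) - f ((-s) • e) := by
      rw [← map_sub, ← sub_smul]; congr 1; ring
    have hAB : f ((2 * s) • e) = (v (x₁ + s • e) - v (x₁ + (-s) • e)) - (A - B) := by
      rw [hf2, hA, hB]; abel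
    have htri : ‖f ((2 * s) • e)‖ ≤ ‖v (x₁ + s • e) - v (x₁ + (-s) • e)‖ + ‖A‖ + ‖B‖ := by
      rw [hAB]; exact (norm_sub_le _ _).trans (by linarith [norm_sub_le A B])
    rw [hfe2] at htri
    -- 2 s ‖f e‖ ≥ 2 s d σ⁻², errors ≤ M₁ s₀ s σ⁻² each, and M₁ s₀ ≤ d/2
    have h1 : 2 * s * (d * (σ ^ 2)⁻¹) ≤ 2 * s * ‖f e‖ := by gcongr
    have h2 : M₁ * (σ ^ 3)⁻¹ * (s₀ * σ) * s = (M₁ * s₀) * s * (σ ^ 2)⁻¹ := by field_simp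
    have h3 : (M₁ * s₀) * s * (σ ^ 2)⁻¹ ≤ (d / 2) * s * (σ ^ 2)⁻¹ := by gcongr
    have h4 : s₁ * d * σ⁻¹ = s * d * (σ ^ 2)⁻¹ := by rw [hs_def]; field_simp
    rw [h4]
    rw [h2] at hplus hminus
    linarith [h1, h3, hplus, hminus, htri]
  obtain ⟨x₂, hx₂, hvx₂⟩ : ∃ x₂ : E3, ‖x₂ - x₁‖ ≤ s ∧ b * σ⁻¹ ≤ ‖v x₂‖ := by
    have hsum : ‖v (x₁ + s • e) - v (x₁ + (-s) • e)‖ ≤ ‖v (x₁ + s • e)‖ + ‖v (x₁ + (-s) • e)‖ := norm_sub_le _ _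
    have hbσ : b * σ⁻¹ = (s₁ * d * σ⁻¹) / 2 := by rw [hb_def]; ring
    by_cases hcase : b * σ⁻¹ ≤ ‖v (x₁ + s • e)‖
    · refine ⟨x₁ + s • e, ?_, hcase⟩
      rw [add_sub_cancel_left, norm_smul, Real.norm_eq_abs, abs_of_pos hs, he1, mul_one]
    · refine ⟨x₁ + (-s) • e, ?_, ?_⟩
      · rw [add_sub_cancel_left, norm_smul, Real.norm_eq_abs, abs_neg, abs_of_pos hs, he1, mul_one]
      · push Not at hcase; linarith
  -- Step 4: Lipschitz persistence on `ball x₂ (r σ)` ⊆ big ball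
  have hx₂y : ‖x₂ - y‖ < (K + 1 / 2) * σ := by
    have h1 : ‖x₂ - y‖ ≤ ‖x₂ - x₁‖ + ‖x₁ - y‖ := norm_sub_le_norm_sub_add_norm_sub _ _ _
    have h2 : s ≤ 1 / 2 * σ := by rw [hs_def]; gcongr
    linarith
  have hsub : ball x₂ (r * σ) ⊆ ball y (2 * K * σ) := by
    intro z hz
    rw [mem_ball_iff_norm] at hz ⊢
    have h1 : ‖z - y‖ ≤ ‖z - x₂‖ + ‖x₂ - y‖ := norm_sub_le_norm_sub_add_norm_sub _ _ _
    have h2 : r * σ ≤ 1 / 2 * σ := by gcongr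
    nlinarith
  have hx₂B : x₂ ∈ ball y (2 * K * σ) := hsub (mem_ball_self (by positivity))
  have hlow : ∀ z ∈ ball x₂ (r * σ), b / (2 * σ) ≤ ‖v z‖ := by
    intro z hz
    have hzB := hsub hz
    have hmv := hconvB.norm_image_sub_le_of_norm_fderiv_le (f := v) (fun x _ => hvd x)
      (fun x hx => hB1 x hx) hx₂B hzB
    have hz' : ‖z - x₂‖ ≤ r * σ := (mem_ball_iff_norm.mp hz).le
    have h1 : ‖v z - v x₂‖ ≤ M₁ * (σ ^ 2)⁻¹ * (r * σ) := hmv.trans (by gcongr)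
    have h2 : M₁ * (σ ^ 2)⁻¹ * (r * σ) = (M₁ * r) * σ⁻¹ := by field_simp
    have h3 : (M₁ * r) * σ⁻¹ ≤ (b / 2) * σ⁻¹ := by gcongr
    have h4 : ‖v x₂‖ ≤ ‖v z‖ + ‖v z - v x₂‖ := by
      have := norm_sub_le_norm_sub_add_norm_sub (v x₂) (v z) 0
      simp only [sub_zero] at this; rw [norm_sub_rev (v x₂) (v z)] at this; linarith
    have h5 : b / (2 * σ) = b * σ⁻¹ - (b / 2) * σ⁻¹ := by field_simp; ring
    rw [h5]; linarith
  -- Step 5: integrate over the small ball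
  have hq0 : 0 ≤ b / (2 * σ) := by positivity
  calc ENNReal.ofReal (b ^ 3 * r ^ 3 * W / 8)
      = ENNReal.ofReal ((b / (2 * σ)) ^ 3) * volume (ball x₂ (r * σ)) := by
        rw [hvol x₂ (r * σ) (by positivity), ← ENNReal.ofReal_mul (by positivity)]
        congr 1; field_simp; ring
    _ = ∫⁻ _ in ball x₂ (r * σ), ENNReal.ofReal ((b / (2 * σ)) ^ 3) := (setLIntegral_const _ _).symm
    _ ≤ ∫⁻ z in ball x₂ (r * σ), ‖v z‖ₑ ^ (3 : ℝ) := by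
        refine setLIntegral_mono' measurableSet_ball (fun z hz => ?_)
        have hq : b / (2 * σ) ≤ ‖v z‖ := hlow z hz
        calc ENNReal.ofReal ((b / (2 * σ)) ^ 3)
            = ENNReal.ofReal (b / (2 * σ)) ^ (3 : ℝ) := by
              rw [ENNReal.ofReal_rpow_of_nonneg hq0 (by norm_num)]
              congr 1
              rw [show (3 : ℝ) = ((3 : ℕ) : ℝ) by norm_num, Real.rpow_natCast]
          _ ≤ ‖v z‖ₑ ^ (3 : ℝ) := by
              refine ENNReal.rpow_le_rpow ?_ (by norm_num)
              rw [← ofReal_norm]; exact ENNReal.ofReal_le_ofReal hq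
    _ ≤ ∫⁻ z in ball y (2 * K * σ), ‖v z‖ₑ ^ (3 : ℝ) := lintegral_mono_set hsub

/-- KERNEL 2 (glue): Sv♯ + Sc″ ⇒ Sc♯. -/
theorem sharpEnstrophyPersistence_of (hV : VorticityTransport) (hS : DriftStretchSilencingCost) :
    SharpEnstrophyPersistence := by
  intro M₁ γ δ Γ₂ hM₁ hγ hδ hΓ₂
  obtain ⟨B, hB, hV⟩ := hV M₁ γ hM₁ hγ
  obtain ⟨K, c, hK, hc, hcδ, hS⟩ := hS B γ δ Γ₂ hB hγ hδ hΓ₂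
  refine ⟨K, c, hK, hc, ?_⟩
  intro T u p hsol y σ t t₁ hσ ht0 htt₁ ht₁T hspan hbox hinit
  rcases eq_or_lt_of_le htt₁ with heq | hlt
  · subst heq
    calc ENNReal.ofReal (c / σ) ≤ ENNReal.ofReal (δ / σ) :=
          ENNReal.ofReal_le_ofReal (div_le_div_of_nonneg_right hcδ hσ.le)
      _ ≤ ∫⁻ x in ball y (Γ₂ * σ), ‖curl (u t) x‖ₑ ^ 2 := hinit
      _ ≤ ∫⁻ x in ball y (K * σ), ‖curl (u t) x‖ₑ ^ 2 :=
          lintegral_mono_set (ball_subset_ball (mul_le_mul_of_nonneg_right hK hσ.le))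
  · have hds := hV T u p hsol y σ (2 * K * σ) t t₁ hσ ht0 hlt ht₁T hbox
    exact hS (fun s => curl (u s)) u y σ t t₁ hσ hlt hspan hds hinit

/-- KERNEL 3: `SharpAftermath → VorticalCentre → SharpEnstrophyPersistence → EmberReadout → TerminalEmber`
(the E2 kernel of `silencing_cost` run with the SHARP box; the tree's proved I1 feeds Sb's energy hypothesis
on the frame restricted to `[0,t]`; room factor `Λ := Γ₂²`, aperture `2K`, deposit `c'`). -/
theorem terminalEmber_of_sharp (hA : SharpAftermath) (hB : VorticalCentre)
    (hC : SharpEnstrophyPersistence) (hD : EmberReadout) : TerminalEmber := by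
  obtain ⟨ε₀, hε₀, hA⟩ := hA
  refine ⟨ε₀, hε₀, fun ε M hε hεle hM => ?_⟩
  obtain ⟨M₁, γ, hM₁, hγ, hA⟩ := hA ε M hε hεle hM
  obtain ⟨C₀, hI⟩ :=
    Summit.NavierStokesRegularity.NavierStokesRegularity.Cruxes.TypeIQuantSubcubicExp.ThinCascade.stub_uniformScaledEnergy
      M
  obtain ⟨Γ₂, δ, hΓ₂, hδ, hB⟩ := hB ε M₁ C₀ hε hM₁
  obtain ⟨K, c, hK, hc, hC⟩ := hC M₁ γ δ Γ₂ hM₁ hγ hδ hΓ₂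
  have hK1 : 1 ≤ K := le_trans hΓ₂ hK
  obtain ⟨c', hc', hD⟩ := hD K M₁ c hK1 hM₁ hc
  refine ⟨2 * K, c', Γ₂ ^ 2, by linarith, hc', by nlinarith, ?_⟩
  intro T τ u p hframe hτ htypeI t₁ y t ht₁ htt₁ hroom hhot hterm
  -- positivity of the clock and of the hot time
  have hTt : 0 < T + τ - t := by linarith [ht₁.2]
  have ht0 : 0 < t := by have h := hhot.1; linarith
  have htT : t ≤ T := le_trans htt₁ ht₁.2
  have htI : t ∈ Icc 0 T := ⟨ht0.le, htT⟩
  have ht₁I : t₁ ∈ Icc 0 T := ⟨ht₁.1.le, ht₁.2⟩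
  have hσpos : 0 < Real.sqrt (T + τ - t) := Real.sqrt_pos.2 hTt
  have hσsq : Real.sqrt (T + τ - t) ^ 2 = T + τ - t := Real.sq_sqrt hTt.le
  have hhot2 : ε < Real.sqrt (T + τ - t) * ‖u t y‖ := hhot.2
  -- (a♯) the sharp box of aperture `2K`
  have hbox4 := hA (2 * K) (by linarith) T τ u p hframe hτ htypeI t₁ y t ht₁ htt₁ hhot hterm
  generalize hσdef : Real.sqrt (T + τ - t) = σ at hσpos hσsq hhot2 hbox4 ⊢
  have hKσ : 0 < K * σ := mul_pos (by linarith) hσpos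
  have hsharp : SharpBoxBound M₁ γ σ u y (Icc t t₁) (2 * K * σ) := sharpBoxBound_mono hbox4 (by nlinarith)
  have hbox : BoxBound M₁ σ u y (Icc t t₁) (2 * K * σ) := hsharp.boxBound
  -- (b) I1 on the frame restricted to `[0,t]` gives the slice energy at radius `Γ₂σ`, then Sb
  have hframe_t := frame_restrict hframe ht0 htT
  have hτ' : 0 < T - t + τ := by linarith
  have hrate_t := typeI_restrict htypeI htT
  have hΓσ : 0 < Γ₂ * σ := mul_pos (by linarith) hσpos
  have hΓσ2 : (Γ₂ * σ) ^ 2 ≤ t := by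
    have e : (Γ₂ * σ) ^ 2 = Γ₂ ^ 2 * (T + τ - t) := by rw [mul_pow, hσsq]
    rw [e]; exact hroom
  have hI1 := (hI t (T - t + τ) u p hframe_t hτ' hrate_t y (Γ₂ * σ) hΓσ hΓσ2).1 t
    ⟨by nlinarith [sq_nonneg (Γ₂ * σ)], le_rfl⟩
  have hv2 : ContDiff ℝ 2 (u t) := (hframe.1.contDiff_velocity htI).of_le (WithTop.coe_le_coe.2 le_top)
  have hgrad : ∀ x ∈ ball y σ, ∀ j : ℕ, j ≤ 2 →
      ‖iteratedFDeriv ℝ j (u t) x‖ ≤ M₁ * σ ^ (-((j : ℝ) + 1)) :=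
    fun x hx j hj => hbox t ⟨le_rfl, htt₁⟩ x (ball_subset_ball (by nlinarith) hx) j hj
  have hvort := hB (u t) y σ hσpos hv2 (hframe.1.divFree t htI) hgrad hI1 hhot2
  -- (c♯) the linear lemma from `t` to `t₁`, sharp box
  have hspan : t₁ ≤ t + σ ^ 2 := by rw [hσsq]; linarith [ht₁.2]
  have hpers := hC T u p hframe.1 y σ t t₁ hσpos ht0.le htt₁ ht₁.2 hspan hsharp hvort
  -- (d) readout at `t₁`
  have hv2' : ContDiff ℝ 2 (u t₁) :=
    (hframe.1.contDiff_velocity ht₁I).of_le (WithTop.coe_le_coe.2 le_top)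
  exact hD (u t₁) y σ hσpos hv2' (fun x hx j hj => hbox t₁ ⟨htt₁, le_rfl⟩ x hx j hj) hpers

/-- **E2 `TerminalEmber` BY NAME, modulo the five stubs ONLY (v1.1: no literature hypothesis — the backward
uniqueness is the tree's PROVED `Carleman.backwardUniqueness_uncurried_c12`; v1.2: Sd PROVED).** -/
theorem terminalEmber_of_smooth_stubs : TerminalEmber :=
  terminalEmber_of_sharp stub_sharpAftermath stub_vorticalCentre
    (sharpEnstrophyPersistence_of stub_vorticityTransport
      (driftStretchSilencingCost_of stub_smoothNormalisation stub_smoothLimitStep))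
    emberReadout_holds

end

end Summit.NavierStokesRegularity.NavierStokesRegularity.Cruxes.TypeIQuantSubcubicExp.SmoothSilence
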